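import Literature.MathematicalPhysics.QuantumFieldTheory.Balaban1983to89.B9Eq373CommLetters
import Literature.MathematicalPhysics.QuantumFieldTheory.Balaban1983to89.B12Eq313JSlot

/-!
# `Balaban1983to89.B9Eq373CurvComm` — B9 p. 405 (3.73) «The derivatives are, of course, the covariant derivatives defined by U» with
# p. 407 «The operator V₃(A) is a local differential operator of the first order satisfying the bound (3.73)», read against the right
# entry (3.42)₃ of Theorem 3.4's `G`-clause (device `B9Ineq386CommSum.thm34_G_entries13_opForm_of_comm_sum`, hypothesis `hComm`): THE
# COMMUTATORS OF THE COEFFICIENT LETTERS OF THE CONCRETE `V₃(A)` WITH THE COVARIANT DIFFERENCES, PART 2 — the two members through the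
# mixing letters `mixLetterF` of (3.71) and `mixLetterB₂` of (3.75), whose transports `τ*_ν`, `τ_μ` do NOT commute with `∇_{k₀}`,
# `∇*_{k₀}`: the transport–difference commutator IS the plaquette holonomy `U(∂p) − 1` of the background, so (3.35) makes these members
# zeroth-order letters of size `O(1)α₁(Lʲη)⁻²` too; with file 6 (`B9Eq373CommLetters`) this COMPLETES `hComm` for the concrete `V₃`
# (`hasMajorant_comm_V₃_one`, every `k ∈ κ ⊕ κ`, group-valued background) — seventh file of the G-side twin

statement-level skeleton of published theorems with citation tags; proofs where landed; nothing here is a claim about the Yang–Mills mass gap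

CITATION HEADER (lean-in-tree rule).  T. Bałaban, *Propagators for lattice gauge theories in a background field*, Commun. Math. Phys.
**99** (1985) 389–434 [Balaban1985BackgroundPropagators] (cell paper B9; held `paper:balaban1985-cmp99-background-propagators`, journal
page = PDF page + 388): (3.1) p. 390 (plaquette variables `U(∂p)`), (3.3)/(3.5) p. 391 (covariant derivative — the display opens at the foot of p. 390, its label (3.3) is printed on p. 391; v1.2: the four decl tags «(3.3) p.390» re-pointed to p.391, citeloc audit P36-005, docstring-only —, transports), (3.35)
p. 396 (regularity of the background: «|A| < O(1)Mα₀(Lʲη)⁻¹, |∇^ηA| < O(1)Mα₀(Lʲη)⁻² on □» for `Uᵘ = e^{iηA}`, whence `|U(∂p) − 1| ≦ O(1)·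
η²(Lʲη)⁻²`-type smallness of the plaquette variables), (3.37) p. 396 («|A′| < α₁(Lʲη)⁻¹, |∇^η_UA′| < α₁(Lʲη)⁻² on Ω_j»), (3.71)–(3.73)
pp. 404–405, (3.75) p. 405, (3.82)/(3.85) p. 407 (page renders `b2b-balaban-ref1/pages/…-p008-x2.png`, `…-p017-x2.png`, `…-p019-x2.png` and the materialised
OCR pages p0016–p0020 re-read by this seat, 2026-08-21).  THE PRINT (verbatim, p. 405): «The operator V₁ satisfies |(V₁(A)A′)(b)| ≦ O(1)(|A|
|∇A′| + |∇A||A′| + |A|²|A′|) ≦ O(1)α₁((Lʲη)⁻¹|∇A′| + (Lʲη)⁻²|A′|), b ∈ Ω_j, (3.73) with the same conditions on norms as above. The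
derivatives are, of course, the covariant derivatives defined by U. The constant O(1) is an absolute constant depending on d only.»;
p. 407: «The operator V₃(A) is a local differential operator of the first order satisfying the bound (3.73).»  The lattice Leibniz
rule: [B8] = T. Bałaban, *Spaces of regular gauge field configurations on a lattice and gauge fixing conditions*, CMP **99** (1985)
75–102 [Balaban1985RegularSpaces], (1.86)–(1.87) p. 91 (v1.1: title/volume corrected, ref-1 gen 45 F4-NIT; docstring-only).  [4] = [Balaban1984PropagatorsII], (2.51)–(2.52) p. 232 (block majorants, «A summation preserves it also»).  Cell
`lit-balaban`, seat r06 (B9 fold owner) gen 10–11; SKELETON rows **B9.Eq3.85** × **B9.Eq3.71** × **B9.Eq3.74** × B9.Eq3.35 × B9.Thm3.4.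
WHY THIS FILE: file 6 closed the `hComm` members of the concrete `V₃` obeying the plain lattice Leibniz rule (`coefLetter`, `mixLetterB`,
`mixLetterF₂`); the members through `mixLetterF`/`mixLetterB₂` contain `D¹_{k₀}(τ*_νG) − τ*_ν(D¹_{k₀}G)` resp. `D¹*_{k₀}(τ_μG) − τ_μ(D¹*_{k₀}
G)`, which is NOT zero for a non-flat background: it is conjugation by (a conjugate of) the plaquette variable of the `(ν,k₀)`- resp.
`(k₀,μ)`-plaquette minus the identity, so its size is governed by (3.35).

THE CURVATURE COMMUTATOR IS CMP 102's WEITZENBÖCK COMMUTATOR.  Since `τ*_ν = D¹*_ν + 1` and `τ_μ = D¹_μ + 1`, `[D¹_k, τ*_ν] =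
[D¹_k, D¹*_ν]` and `[D¹*_k, τ_μ] = −[D¹_μ, D¹*_k]`: the commutator behind (135) of [15] = T. Bałaban, *The variational problem and background
fields in renormalization group method for lattice gauge theories*, CMP **102** (1985) 277–309 [Balaban1985Variational], (135) p. 298,
ALREADY VENDORED in `B11Eq135Weitzenbock` (`covD_covDstar_sub_covDstar_covD`: `D_μD*_ν − D*_νD_μ = −R(transp)[R(U(∂p′_μν)) − 1]` on
commuting shifts; `plaqU'`, `transp`, `shift_symm_comm`, `plaqU'_eq_conj`) with its `ρ`-background size `B12Eq313JSlot.norm_curvOp_summand_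
le_of_le` (`≦ 2ρ¹⁰‖U(∂p_{μν}(x − e_ν)) − 1‖·‖·‖`) — REUSED BY NAME (found by the gate's dedup check on this file's first draft, whose own
transport computation restated `B12Eq313JSlot.norm_R_sub_self_le_of_le`; that draft is withdrawn).

SIBLINGS REUSED BY NAME (imported; nothing restated): `B11Eq135Weitzenbock.covD_covDstar_sub_covDstar_covD`/`shift_symm_comm`/`plaqU'`/
`transp`, `B12Eq313JSlot.norm_curvOp_summand_le_of_le`; file 6 `B9Eq373CommLetters.hasMajorant_comm_coefLetter_bond`/
`hasMajorant_comm_V1Letter_inr`/`hasMajorant_comm_V1Letter₂_inl`; files 1–2 `mixLetterF(_apply)`, `mixLetterB₂(_apply)`, `V1Letter(_inl)`,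
`V1Letter₂(_inr)`, `bT`/`bU`/`Ab`, `covD_bond`/`covDstar_bond`; gen 8 `conj`, `conj_mul/sub/neg/add`, `diffLetter_inl/inr`,
`gradLetterF/B_apply`, the seam lemma `hasMajorant_conj_of_local`; `B9Eq39Adjoint.plaqU`/`R`/`covD`/`covDstar`; pv27 `R_ad`,
`B9Eq369Small.norm_R_le_rho`/`norm_R_inv_le_rho`; `B9Eq352DivForm.tauF`/`tauB`.

WHAT THIS FILE PROVES (0 sorry; theorems only; no definitions, no `def … : Prop`).
* §1 THE CURVATURE LEMMA: `covD_tauB_comm_eq` (`[D¹_k, τ*_ν] = [D¹_k, D¹*_ν]`, no hypothesis) and `covDstar_tauF_comm_eq` (`[D¹*_k, τ_μ] =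
  −[D¹_μ, D¹*_k]`); on commuting shifts **`covD_tauB_comm`** (`D¹_k(τ*_νG)(x) − τ*_ν(D¹_kG)(x) = −R(U_k(x)U_ν(z)⁻¹)[R(U(∂p′_{kν}(x))) − 1]G(z)`,
  `z = x + e_k − e_ν`, by the Weitzenböck commutator) and its twin **`covDstar_tauF_comm`**; the sizes **`norm_covD_tauB_comm_le`**,
  **`norm_covDstar_tauF_comm_le`** (`≦ 2ρ¹⁰‖U(∂p_{kν}(x − e_ν)) − 1‖‖G(z)‖` for transports `‖U^{±1}‖ ≦ ρ`) and the derived letter sizes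
  `norm_smul_covD_tauB_le`, `norm_smul_covDstar_tauF_le` (`‖η⁻¹D¹_k(τ*_νa)(x)‖ ≦ ρ²‖η⁻¹(D¹_ka)(x − e_ν)‖ + η⁻¹·2ρ¹⁰‖U(∂p) − 1‖‖a(z)‖`: the
  transported coefficient's difference is the transported difference plus a curvature term).
* §2 THE EXACT COMMUTATOR IDENTITIES, pointwise: **`comm_mixLetterF_apply`** — `([mixLetterF A k₀, ∇_{inl k₀}]F)(μ,x) = 𝟙[μ = k₀]·Σ_ν(
  i[τ*_νA_ν, η⁻¹[D¹_{k₀}, τ*_ν]F_ν] − i[τ*_νA_{k₀}, η⁻¹[D¹_{k₀}, τ*_ν]F_ν] + i[η⁻¹D¹_{k₀}(τ*_νA_ν), τ_{k₀}τ*_νF_ν] − i[η⁻¹D¹_{k₀}(τ*_νA_{k₀}), τ_{k₀}τ*_ν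
  F_ν] + i[η⁻¹D¹_{k₀}A_{k₀}, τ_{k₀}F_ν] )(x)` (lattice Leibniz rule term by term; the `i[A_{k₀}, ∇F_ν]` parts cancel) and **`comm_mixLetterB₂_apply`**
  — `([mixLetterB₂ A k₀, ∇_{inr k₀}]G)(μ,x) = ( i[A_μ, η⁻¹[D¹*_{k₀}, τ_μ]G_{k₀}] − i[τ_μA_{k₀}, η⁻¹[D¹*_{k₀}, τ_μ]G_{k₀}] + i[η⁻¹D¹*_{k₀}A_μ, τ*_{k₀}τ_μG_{k₀}] −
  i[η⁻¹D¹*_{k₀}(τ_μA_{k₀}), τ*_{k₀}τ_μG_{k₀}] + i[η⁻¹D¹*_{k₀}A_{k₀}, τ*_{k₀}G_{k₀}] )(x)` (no hypothesis on the shifts: the commutators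
  `[D¹_{k₀}, τ*_ν]`, `[D¹*_{k₀}, τ_μ]` are kept as they are; §1 evaluates them for commuting shifts).
* §3 BLOCK MAJORANTS after real coordinates (block map `((μ,x),i) ↦ y(x)`; seam lemma), for COMMUTING SHIFTS, lattice spacing `η = g.eta >
  0`, `L ≧ 1` (so `η ≦ Lʲη = g.len y`), (3.35) read as `‖U(∂p_{mn}(x − e_n)) − 1‖ ≦ C₀L^{−2j(y(x))}` on the plaquettes adjacent to the output
  bond, (3.37) read blockwise for `A` and its covariant differences as they occur, transports `‖U^{±1}‖ ≦ ρ`, stencil block distances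
  `≦ d₀`: **`hasMajorant_comm_mixLetterF`** (`≺ d(2ρ² + 4ρ⁶ + (8ρ¹⁰ + 8ρ¹⁴)C₀)·M·α₁(Lʲη)⁻²e^{−δd}`, `M = M₂(Σ‖b_i‖)e^{δd₀}`),
  **`hasMajorant_comm_mixLetterB₂`** (`≺ (2ρ² + 2ρ⁴ + 2ρ⁶ + (8ρ¹⁰ + 4ρ¹⁴)C₀)·M·α₁(Lʲη)⁻²e^{−δd}`), the members **`hasMajorant_comm_V1Letter_inl`**
  (`V1Letter (inl k₀) = coefLetter (inl k₀) + mixLetterF k₀`; file 6's diagonal part + the above) and **`hasMajorant_comm_V1Letter₂_inr`**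
  (`V1Letter₂ (inr k₀) = mixLetterB₂ k₀`), and — with file 6's two members — **`hasMajorant_comm_V₃_one`**: for a GROUP-VALUED background
  (`ρ = 1`) and every `k ∈ κ ⊕ κ`, `[conj b (V1Letter A k) + conj b (V1Letter₂ A k), conj b (∇_k)] ≺ c_K(d, C₀)·M·α₁(Lʲη)⁻²·e^{−δd}` with
  `c_K(d, C₀) = 10 + 8d + (16d + 12)C₀` explicit — the `hComm` input of `thm34_G_entries13_opForm_of_comm_sum` for the CONCRETE `V₃(A)` of (3.82)
  (`V1 k`, `D k` exactly as in `B9Ineq385V3Concrete.ineq385_op_concreteV₃`).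

HONEST SCOPE / NOT CLAIMED.  (i) COMMUTING SHIFTS `T_k(T_νy) = T_ν(T_ky)` are a hypothesis (true on `ℤᵈ` and on the tori; pv27's abstract
shift model does not assume it) — without it the plaquette does not close.  (ii) (3.35) enters as the hypothesis `‖U(∂p_{mn}(x − e_n)) − 1‖
≦ C₀·L^{−2j(y(x))}` for ALL ordered pairs `(m,n)` (both orientations — `B12Eq313JSlot.norm_plaqU_swap_sub_one_le` converts; `m = n` is
vacuous since `U(∂p_{mm}) = 1`), at the output block's scale; deriving it from (3.35) as printed (a bound on the gauge-fixed exponent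
field `A` of `U`) is `B9Eq335Plaquette`'s business, not redone.  (iii) (3.37) enters BLOCKWISE in the shapes the letters read it (undifferentiated `A`, `τ*_νA`, `τ_μA`, `A` two steps away;
`η⁻¹D¹A`, `η⁻¹D¹*A` at the output point and one step away), transports `≦ ρ`, stencil geometry — as in files 1–6; the O(1)'s are explicit
polynomials in `ρ`, NOT optimised.  (iv) This file discharges `hComm` only; entry (3.42)₃ for the concrete `V₃` (the device's assembly
with `P₁`, `P₂`, (3.76)/(3.80), `G(U)`'s Theorem-3.3 entries) is the successor file.  Value = the last `V₃`-side letter hypothesis of the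
G-side Theorem-3.4 devices made a theorem about the concrete lattice operators; NOT summit progress.

RELATED IN THE TREE, NOT DUPLICATED (searched 2026-08-21: `lean search --decl 'covD_tauB_comm|covDstar_tauF_comm|comm_mixLetterF_apply|
comm_mixLetterB₂|hasMajorant_comm_V₃|curv_coeff_le|bracketF_comm'` = ∅; the Weitzenböck commutator and its bounds
(`B11Eq135Weitzenbock`, `B12Eq313JSlot`) are IMPORTED and used BY NAME, see above; pv27's `B9Eq369Small`/`B9Eq373V3` bound `U(∂p) − 1` and
its `Re`/`Im` weights, not the transport commutator; `B9Eq336CurrentBound.plaqU_self` / `B11Eq135Weitzenbock.plaqU'_self` are the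
diagonal trivialities, not needed here).
-/

noncomputable section

namespace Literature.MathematicalPhysics.QuantumFieldTheory.Balaban1983to89.B9Eq373CurvComm

open NormedSpace Complex
open Literature.MathematicalPhysics.QuantumFieldTheory.Balaban1983to89
open Literature.MathematicalPhysics.QuantumFieldTheory.Balaban1983to89.B6RandomWalk (HasMajorant hasMajorant_mono hasMajorant_add)
open Literature.MathematicalPhysics.QuantumFieldTheory.Balaban1983to89.B9Thm34Ext (toB6)
open Literature.MathematicalPhysics.QuantumFieldTheory.Balaban1983to89.Beta.BackgroundVertices (ad norm_ad_le ad_smul_left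
  ad_smul_right ad_sub_left ad_sub_right ad_add_left ad_add_right ad_neg_left)
open Literature.MathematicalPhysics.QuantumFieldTheory.Balaban1983to89.B9Eq39Adjoint
open Literature.MathematicalPhysics.QuantumFieldTheory.Balaban1983to89.B9Eq369Small (norm_R_le_rho norm_R_inv_le_rho)
open Literature.MathematicalPhysics.QuantumFieldTheory.Balaban1983to89.B11Eq135Weitzenbock (plaqU' transp shift_symm_comm
  covD_covDstar_sub_covDstar_covD)
open Literature.MathematicalPhysics.QuantumFieldTheory.Balaban1983to89.B12Eq313JSlot (norm_curvOp_summand_le_of_le)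
open Literature.MathematicalPhysics.QuantumFieldTheory.Balaban1983to89.B9Eq371Composition (R_ad)
open Literature.MathematicalPhysics.QuantumFieldTheory.Balaban1983to89.B9Eq352DivForm (tauF tauB tauF_apply tauB_apply)
open Literature.MathematicalPhysics.QuantumFieldTheory.Balaban1983to89.B9Eq352DivFormLetters
open Literature.MathematicalPhysics.QuantumFieldTheory.Balaban1983to89.B9Eq352GradLetters (coefLetter diffLetter diffLetter_inl
  diffLetter_inr conj_add)
open Literature.MathematicalPhysics.QuantumFieldTheory.Balaban1983to89.B9Eq371GradLetters (bT bU Ab bT_apply bT_symm_apply bU_apply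
  Ab_apply covD_bond covDstar_bond mixLetterF mixLetterF_apply V1Letter V1Letter_inl)
open Literature.MathematicalPhysics.QuantumFieldTheory.Balaban1983to89.B9Eq375GradLetters (mixLetterB₂ mixLetterB₂_apply V1Letter₂
  V1Letter₂_inr)
open Literature.MathematicalPhysics.QuantumFieldTheory.Balaban1983to89.B9Eq373CommLetters (hasMajorant_comm_coefLetter_bond
  hasMajorant_comm_V1Letter_inr hasMajorant_comm_V1Letter₂_inl)

/-! ## §1  The curvature lemma: `[D¹_k, τ*_ν]` and `[D¹*_k, τ_μ]` are the Weitzenböck commutator `[D, D*]` = plaquette holonomy -/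

section Curvature

variable {𝔸 : Type*} [NormedRing 𝔸] {S : Type} {κ : Type}
variable (T : κ → Equiv.Perm S) (U : κ → S → 𝔸ˣ)

/-- `[D¹_k, τ*_ν] = [D¹_k, D¹*_ν]` (`τ*_ν = D¹*_ν + 1`, (3.8)): `D¹_k(τ*_νG)(x) − τ*_ν(D¹_kG)(x) = D¹_kD¹*_νG(x) − D¹*_νD¹_kG(x)` — no hypothesis on
the shifts. [cite: Balaban1985BackgroundPropagators, (3.3) p.391 + (3.8) p.392 + (3.5) p.391] -/
theorem covD_tauB_comm_eq (k ν : κ) (G : S → 𝔸) (x : S) :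
    covD T U k (tauB T U ν G) x - tauB T U ν (covD T U k G) x
      = covD T U k (covDstar T U ν G) x - covDstar T U ν (covD T U k G) x := by
  simp only [covD, covDstar, tauB_apply, R_sub]
  abel

/-- The twin: `[D¹*_k, τ_μ] = −[D¹_μ, D¹*_k]` (`τ_μ = D¹_μ + 1`, (3.3)). [cite: Balaban1985BackgroundPropagators, (3.3) p.391 + (3.8) p.392] -/
theorem covDstar_tauF_comm_eq (k μ : κ) (G : S → 𝔸) (x : S) :
    covDstar T U k (tauF T U μ G) x - tauF T U μ (covDstar T U k G) x
      = -(covD T U μ (covDstar T U k G) x - covDstar T U k (covD T U μ G) x) := by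
  simp only [covD, covDstar, tauF_apply, R_sub]
  abel

/-- **`[D¹_k, τ*_ν]` IS THE PLAQUETTE HOLONOMY** (commuting shifts): `D¹_k(τ*_νG)(x) − τ*_ν(D¹_kG)(x) = −R(U_k(x)U_ν(z)⁻¹)·[R(U(∂p′_{kν}(x))) −
1]G(z)`, `z = x + e_k − e_ν` — CMP 102's Weitzenböck commutator (135) (`B11Eq135Weitzenbock.covD_covDstar_sub_covDstar_covD`, REUSED BY
NAME; `U(∂p′_{kν}(x))` is conjugate to `B9Eq39Adjoint.plaqU T U k ν (x − e_ν)` by `plaqU'_eq_conj`).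
[cite: Balaban1985BackgroundPropagators, (3.3) p.391 + (3.5) p.391 + (3.73) p.405; Balaban1985Variational, (135) p.298] -/
theorem covD_tauB_comm (hT : ∀ (μ ν : κ) (x : S), T μ (T ν x) = T ν (T μ x)) (k ν : κ) (G : S → 𝔸) (x : S) :
    covD T U k (tauB T U ν G) x - tauB T U ν (covD T U k G) x
      = -(R (transp T U k ν x) (R (plaqU' T U k ν x) (G ((T ν).symm (T k x))) - G ((T ν).symm (T k x)))) := by
  rw [covD_tauB_comm_eq, covD_covDstar_sub_covDstar_covD T U hT]

/-- **`[D¹*_k, τ_μ]` IS THE PLAQUETTE HOLONOMY** (the twin): `D¹*_k(τ_μG)(x) − τ_μ(D¹*_kG)(x) = R(U_μ(x)U_k(z′)⁻¹)·[R(U(∂p′_{μk}(x))) − 1]G(z′)`,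
`z′ = x + e_μ − e_k`. [cite: Balaban1985BackgroundPropagators, (3.8) p.392 + (3.5) p.391 + (3.75) p.405; Balaban1985Variational, (135) p.298] -/
theorem covDstar_tauF_comm (hT : ∀ (μ ν : κ) (x : S), T μ (T ν x) = T ν (T μ x)) (k μ : κ) (G : S → 𝔸) (x : S) :
    covDstar T U k (tauF T U μ G) x - tauF T U μ (covDstar T U k G) x
      = R (transp T U μ k x) (R (plaqU' T U μ k x) (G ((T k).symm (T μ x))) - G ((T k).symm (T μ x))) := by
  rw [covDstar_tauF_comm_eq, covD_covDstar_sub_covDstar_covD T U hT, neg_neg]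

/-- **`‖[D¹_k, τ*_ν]G(x)‖ ≦ 2ρ¹⁰·‖U(∂p_{kν}(x − e_ν)) − 1‖·‖G(x + e_k − e_ν)‖`** for commuting shifts and `‖U(b′)^{±1}‖ ≦ ρ`
(`B12Eq313JSlot.norm_curvOp_summand_le_of_le` BY NAME) — the input by which (3.35) makes the curvature commutators of the mixing letters
zeroth-order letters of size `O(1)α₁(Lʲη)⁻²`. [cite: Balaban1985BackgroundPropagators, (3.35) p.396 + (3.73) p.405 + (3.85) p.407; Balaban1985Variational, (135) p.298] -/
theorem norm_covD_tauB_comm_le (hT : ∀ (μ ν : κ) (x : S), T μ (T ν x) = T ν (T μ x)) {ρ : ℝ}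
    (hρ : ∀ μ x, ‖((U μ x : 𝔸ˣ) : 𝔸)‖ ≤ ρ ∧ ‖(((U μ x)⁻¹ : 𝔸ˣ) : 𝔸)‖ ≤ ρ) (k ν : κ) (G : S → 𝔸) (x : S) :
    ‖covD T U k (tauB T U ν G) x - tauB T U ν (covD T U k G) x‖
      ≤ 2 * ρ ^ 10 * ‖(plaqU T U k ν ((T ν).symm x) : 𝔸) - 1‖ * ‖G ((T ν).symm (T k x))‖ := by
  rw [covD_tauB_comm T U hT, norm_neg]
  exact norm_curvOp_summand_le_of_le T U hT hρ (fun _ => G) k ν x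

/-- **`‖[D¹*_k, τ_μ]G(x)‖ ≦ 2ρ¹⁰·‖U(∂p_{μk}(x − e_k)) − 1‖·‖G(x + e_μ − e_k)‖`** (the twin).
[cite: Balaban1985BackgroundPropagators, (3.35) p.396 + (3.73) p.405 + (3.75) p.405; Balaban1985Variational, (135) p.298] -/
theorem norm_covDstar_tauF_comm_le (hT : ∀ (μ ν : κ) (x : S), T μ (T ν x) = T ν (T μ x)) {ρ : ℝ}
    (hρ : ∀ μ x, ‖((U μ x : 𝔸ˣ) : 𝔸)‖ ≤ ρ ∧ ‖(((U μ x)⁻¹ : 𝔸ˣ) : 𝔸)‖ ≤ ρ) (k μ : κ) (G : S → 𝔸) (x : S) :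
    ‖covDstar T U k (tauF T U μ G) x - tauF T U μ (covDstar T U k G) x‖
      ≤ 2 * ρ ^ 10 * ‖(plaqU T U μ k ((T k).symm x) : 𝔸) - 1‖ * ‖G ((T k).symm (T μ x))‖ := by
  rw [covDstar_tauF_comm T U hT]
  exact norm_curvOp_summand_le_of_le T U hT hρ (fun _ => G) μ k x

variable [NormedAlgebra ℂ 𝔸]

/-- **THE DIFFERENCE OF A TRANSPORTED COEFFICIENT = THE TRANSPORTED DIFFERENCE + A CURVATURE TERM**: `‖c·D¹_k(τ*_νa)(x)‖ ≦ ρ²‖c·(D¹_ka)(x −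
e_ν)‖ + ‖c‖·2ρ¹⁰‖U(∂p_{kν}(x − e_ν)) − 1‖·‖a(x + e_k − e_ν)‖` (commuting shifts; `c = η⁻¹`) — how (3.37) for `∇A` and (3.35) bound the
letters `η⁻¹D¹_{k₀}(τ*_νA)` of the mixing commutator. [cite: Balaban1985BackgroundPropagators, (3.37) p.396 + (3.35) p.396 + (3.73) p.405; Balaban1985Variational, (135) p.298] -/
theorem norm_smul_covD_tauB_le (hT : ∀ (μ ν : κ) (x : S), T μ (T ν x) = T ν (T μ x)) {ρ : ℝ}
    (hρ : ∀ μ x, ‖((U μ x : 𝔸ˣ) : 𝔸)‖ ≤ ρ ∧ ‖(((U μ x)⁻¹ : 𝔸ˣ) : 𝔸)‖ ≤ ρ) (k ν : κ) (c : ℂ) (a : S → 𝔸) (x : S) :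
    ‖c • covD T U k (tauB T U ν a) x‖
      ≤ ρ ^ 2 * ‖c • covD T U k a ((T ν).symm x)‖
        + ‖c‖ * (2 * ρ ^ 10 * ‖(plaqU T U k ν ((T ν).symm x) : 𝔸) - 1‖ * ‖a ((T ν).symm (T k x))‖) := by
  have e : c • covD T U k (tauB T U ν a) x
      = R (U ν ((T ν).symm x))⁻¹ (c • covD T U k a ((T ν).symm x))
        + c • (covD T U k (tauB T U ν a) x - tauB T U ν (covD T U k a) x) := by
    rw [R_smul, ← tauB_apply, ← smul_add, add_sub_cancel]
  rw [e]
  refine (norm_add_le _ _).trans (add_le_add (norm_R_inv_le_rho (hρ ν _).1 (hρ ν _).2 _) ?_)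
  rw [norm_smul]
  exact mul_le_mul_of_nonneg_left (norm_covD_tauB_comm_le T U hT hρ k ν a x) (norm_nonneg _)

/-- The twin: `‖c·D¹*_k(τ_μa)(x)‖ ≦ ρ²‖c·(D¹*_ka)(x + e_μ)‖ + ‖c‖·2ρ¹⁰‖U(∂p_{μk}(x − e_k)) − 1‖·‖a(x + e_μ − e_k)‖`.
[cite: Balaban1985BackgroundPropagators, (3.37) p.396 + (3.35) p.396 + (3.75) p.405; Balaban1985Variational, (135) p.298] -/
theorem norm_smul_covDstar_tauF_le (hT : ∀ (μ ν : κ) (x : S), T μ (T ν x) = T ν (T μ x)) {ρ : ℝ}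
    (hρ : ∀ μ x, ‖((U μ x : 𝔸ˣ) : 𝔸)‖ ≤ ρ ∧ ‖(((U μ x)⁻¹ : 𝔸ˣ) : 𝔸)‖ ≤ ρ) (k μ : κ) (c : ℂ) (a : S → 𝔸) (x : S) :
    ‖c • covDstar T U k (tauF T U μ a) x‖
      ≤ ρ ^ 2 * ‖c • covDstar T U k a (T μ x)‖
        + ‖c‖ * (2 * ρ ^ 10 * ‖(plaqU T U μ k ((T k).symm x) : 𝔸) - 1‖ * ‖a ((T k).symm (T μ x))‖) := by
  have e : c • covDstar T U k (tauF T U μ a) x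
      = R (U μ x) (c • covDstar T U k a (T μ x))
        + c • (covDstar T U k (tauF T U μ a) x - tauF T U μ (covDstar T U k a) x) := by
    rw [R_smul, ← tauF_apply, ← smul_add, add_sub_cancel]
  rw [e]
  refine (norm_add_le _ _).trans (add_le_add (norm_R_le_rho (hρ μ _).1 (hρ μ _).2 _) ?_)
  rw [norm_smul]
  exact mul_le_mul_of_nonneg_left (norm_covDstar_tauF_comm_le T U hT hρ k μ a x) (norm_nonneg _)

end Curvature

/-! ## §2  The exact commutator identities of the curvature members (lattice Leibniz rule; the transport commutators kept) -/

section Identities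

variable {𝔸 : Type*} [NormedRing 𝔸] [NormedAlgebra ℂ 𝔸] {S : Type} {κ : Type}
variable (T : κ → Equiv.Perm S) (U : κ → S → 𝔸ˣ)

omit [NormedAlgebra ℂ 𝔸] T U in
/-- `R(V)` of a finite sum. [folklore] -/
private theorem R_finset_sum {α : Type*} (V : 𝔸ˣ) (s : Finset α) (f : α → 𝔸) :
    R V (∑ i ∈ s, f i) = ∑ i ∈ s, R V (f i) := by
  simp only [R_def, Finset.mul_sum, Finset.sum_mul]

omit [NormedAlgebra ℂ 𝔸] in
/-- `D¹_k` of a finite sum of lattice functions. [folklore] [cite: Balaban1985BackgroundPropagators, (3.3) p.391] -/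
private theorem covD_fun_sum {α : Type*} (s : Finset α) (k : κ) (f : α → S → 𝔸) (x : S) :
    covD T U k (fun w => ∑ i ∈ s, f i w) x = ∑ i ∈ s, covD T U k (f i) x := by
  simp only [covD, R_finset_sum, ← Finset.sum_sub_distrib]

/-- **THE `ν`-SUMMAND OF `[mixLetterF, ∇_{k}]`** (generic coefficients `a₁ = τ*_ν`-read `A_ν`, `a₂ = A_k`, test field `f = F_ν`): the
lattice Leibniz rule `c·D¹_k(i[a, g]) = i[c·D¹_ka, τ_kg] + i[a, c·D¹_kg]` applied to the three terms; the `i[a₂, c·D¹_kf]` parts cancel and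
`τ*_ν(c·D¹_kf) − c·D¹_k(τ*_νf) = −c·[D¹_k, τ*_ν]f` remains. [cite: Balaban1985BackgroundPropagators, (3.71) p.404–405 + (3.73) p.405; Balaban1985RegularSpaces, (1.86)–(1.87) p.91] -/
theorem bracketF_comm (c : ℂ) (k ν : κ) (a₁ a₂ f : S → 𝔸) (x : S) :
    (-((I : ℂ) • ad (tauB T U ν a₁ x) (tauB T U ν (fun z => c • covD T U k f z) x))
        + (I : ℂ) • ad (tauB T U ν a₂ x) (tauB T U ν (fun z => c • covD T U k f z) x)
        - (I : ℂ) • ad (a₂ x) (c • covD T U k f x))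
      - c • covD T U k (fun w => -((I : ℂ) • ad (tauB T U ν a₁ w) (tauB T U ν f w))
          + (I : ℂ) • ad (tauB T U ν a₂ w) (tauB T U ν f w) - (I : ℂ) • ad (a₂ w) (f w)) x
    = (I : ℂ) • ad (tauB T U ν a₁ x) (c • (covD T U k (tauB T U ν f) x - tauB T U ν (covD T U k f) x))
      - (I : ℂ) • ad (tauB T U ν a₂ x) (c • (covD T U k (tauB T U ν f) x - tauB T U ν (covD T U k f) x))
      + (I : ℂ) • ad (c • covD T U k (tauB T U ν a₁) x) (tauF T U k (tauB T U ν f) x)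
      - (I : ℂ) • ad (c • covD T U k (tauB T U ν a₂) x) (tauF T U k (tauB T U ν f) x)
      + (I : ℂ) • ad (c • covD T U k a₂ x) (tauF T U k f x) := by
  have hcI : c * I = I * c := mul_comm c I
  simp only [covD, tauB_apply, tauF_apply, R_add, R_sub, R_neg, R_smul, R_ad, ad_sub_left, ad_sub_right, ad_smul_left,
    ad_smul_right, smul_add, smul_sub, smul_neg, smul_smul, hcI]
  abel

/-- **THE SUMMAND OF `[mixLetterB₂, ∇_{inr k}]`** (generic coefficients `a₀ = A_μ`, `a₂ = A_k`, test field `g = G_k`; `∇_{inr k} =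
−c·D¹*_k`): backward lattice Leibniz rule [B8] (1.87); the `i[·, c·D¹*_kg]` parts cancel, `−c·[D¹*_k, τ_μ]g` remains.
[cite: Balaban1985BackgroundPropagators, (3.75) p.405 + (3.73) p.405; Balaban1985RegularSpaces, (1.86)–(1.87) p.91] -/
theorem bracketB₂_comm (c : ℂ) (k μ : κ) (a₀ a₂ g : S → 𝔸) (x : S) :
    -((I : ℂ) • ad (a₀ x) (tauF T U μ (fun z => c • covDstar T U k g z) x)
        - (I : ℂ) • ad (tauF T U μ a₂ x) (tauF T U μ (fun z => c • covDstar T U k g z) x)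
        + (I : ℂ) • ad (a₂ x) (c • covDstar T U k g x))
      + c • covDstar T U k (fun w => (I : ℂ) • ad (a₀ w) (tauF T U μ g w)
          - (I : ℂ) • ad (tauF T U μ a₂ w) (tauF T U μ g w) + (I : ℂ) • ad (a₂ w) (g w)) x
    = (I : ℂ) • ad (a₀ x) (c • (covDstar T U k (tauF T U μ g) x - tauF T U μ (covDstar T U k g) x))
      - (I : ℂ) • ad (tauF T U μ a₂ x) (c • (covDstar T U k (tauF T U μ g) x - tauF T U μ (covDstar T U k g) x))
      + (I : ℂ) • ad (c • covDstar T U k a₀ x) (tauB T U k (tauF T U μ g) x)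
      - (I : ℂ) • ad (c • covDstar T U k (tauF T U μ a₂) x) (tauB T U k (tauF T U μ g) x)
      + (I : ℂ) • ad (c • covDstar T U k a₂ x) (tauB T U k g x) := by
  have hcI : c * I = I * c := mul_comm c I
  simp only [covDstar, tauB_apply, tauF_apply, R_add, R_sub, R_smul, R_ad, ad_sub_left, ad_sub_right, ad_smul_left,
    ad_smul_right, smul_add, smul_sub, smul_smul, hcI]
  abel

variable [Fintype κ] [DecidableEq κ]

/-- **`[mixLetterF A k₀, ∇_{inl k₀}]` EXACTLY, pointwise** (`∇_{inl k₀} = η⁻¹D¹_{k₀}` on the bond carrier; no hypothesis on the shifts):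
`((mixLetterF A k₀ ∘ ∇ − ∇ ∘ mixLetterF A k₀)F)(μ,x) = 𝟙[μ = k₀]·Σ_ν( i[τ*_νA_ν, c[D¹_{k₀}, τ*_ν]F_ν] − i[τ*_νA_{k₀}, c[D¹_{k₀}, τ*_ν]F_ν] +
i[cD¹_{k₀}(τ*_νA_ν), τ_{k₀}τ*_νF_ν] − i[cD¹_{k₀}(τ*_νA_{k₀}), τ_{k₀}τ*_νF_ν] + i[cD¹_{k₀}A_{k₀}, τ_{k₀}F_ν] )(x)` — the lattice Leibniz rule for the
component-mixing letter of (3.71): zeroth-order letters `i[∇(coefficient), transported ·]` plus the transport–difference commutators.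
[cite: Balaban1985BackgroundPropagators, (3.71) p.404–405 + (3.73) p.405; Balaban1985RegularSpaces, (1.86)–(1.87) p.91] -/
theorem comm_mixLetterF_apply (c : ℂ) (A : κ → S → 𝔸) (k₀ : κ) (F : κ × S → 𝔸) (p : κ × S) :
    (mixLetterF T U A k₀ * diffLetter (bT T) (bU U) c (Sum.inl k₀)
        - diffLetter (bT T) (bU U) c (Sum.inl k₀) * mixLetterF T U A k₀) F p
      = (if p.1 = k₀ then (1 : ℝ) else 0) • ∑ ν,
          ((I : ℂ) • ad (tauB T U ν (A ν) p.2)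
              (c • (covD T U k₀ (tauB T U ν (fun z => F (ν, z))) p.2 - tauB T U ν (covD T U k₀ (fun z => F (ν, z))) p.2))
            - (I : ℂ) • ad (tauB T U ν (A k₀) p.2)
              (c • (covD T U k₀ (tauB T U ν (fun z => F (ν, z))) p.2 - tauB T U ν (covD T U k₀ (fun z => F (ν, z))) p.2))
            + (I : ℂ) • ad (c • covD T U k₀ (tauB T U ν (A ν)) p.2) (tauF T U k₀ (tauB T U ν (fun z => F (ν, z))) p.2)
            - (I : ℂ) • ad (c • covD T U k₀ (tauB T U ν (A k₀)) p.2) (tauF T U k₀ (tauB T U ν (fun z => F (ν, z))) p.2)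
            + (I : ℂ) • ad (c • covD T U k₀ (A k₀) p.2) (tauF T U k₀ (fun z => F (ν, z)) p.2)) := by
  obtain ⟨μ, x⟩ := p
  simp only [LinearMap.sub_apply, Module.End.mul_apply, Pi.sub_apply, diffLetter_inl, gradLetterF_apply, covD_bond,
    mixLetterF_apply]
  by_cases hμ : μ = k₀
  · subst hμ
    simp only [if_true, one_smul]
    rw [covD_fun_sum, Finset.smul_sum, ← Finset.sum_sub_distrib]
    exact Finset.sum_congr rfl fun ν _ => bracketF_comm T U c μ ν (A ν) (A μ) (fun z => F (ν, z)) x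
  · simp only [hμ, if_false, zero_smul, covD, R_zero, sub_zero, smul_zero]

omit [Fintype κ] [DecidableEq κ] in
/-- **`[mixLetterB₂ A k₀, ∇_{inr k₀}]` EXACTLY, pointwise** (`∇_{inr k₀} = −η⁻¹D¹*_{k₀}` on the bond carrier; no hypothesis on the shifts):
`((mixLetterB₂ A k₀ ∘ ∇ − ∇ ∘ mixLetterB₂ A k₀)G)(μ,x) = ( i[A_μ, c[D¹*_{k₀}, τ_μ]G_{k₀}] − i[τ_μA_{k₀}, c[D¹*_{k₀}, τ_μ]G_{k₀}] + i[cD¹*_{k₀}A_μ,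
τ*_{k₀}τ_μG_{k₀}] − i[cD¹*_{k₀}(τ_μA_{k₀}), τ*_{k₀}τ_μG_{k₀}] + i[cD¹*_{k₀}A_{k₀}, τ*_{k₀}G_{k₀}] )(x)` — the backward lattice Leibniz rule for the
mixing letter of (3.75) (terms 1–3). [cite: Balaban1985BackgroundPropagators, (3.75) p.405 + (3.73) p.405; Balaban1985RegularSpaces, (1.86)–(1.87) p.91] -/
theorem comm_mixLetterB₂_apply (c : ℂ) (A : κ → S → 𝔸) (k₀ : κ) (G : κ × S → 𝔸) (p : κ × S) :
    (mixLetterB₂ T U A k₀ * diffLetter (bT T) (bU U) c (Sum.inr k₀)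
        - diffLetter (bT T) (bU U) c (Sum.inr k₀) * mixLetterB₂ T U A k₀) G p
      = (I : ℂ) • ad (A p.1 p.2)
          (c • (covDstar T U k₀ (tauF T U p.1 (fun z => G (k₀, z))) p.2 - tauF T U p.1 (covDstar T U k₀ (fun z => G (k₀, z))) p.2))
        - (I : ℂ) • ad (tauF T U p.1 (A k₀) p.2)
          (c • (covDstar T U k₀ (tauF T U p.1 (fun z => G (k₀, z))) p.2 - tauF T U p.1 (covDstar T U k₀ (fun z => G (k₀, z))) p.2))
        + (I : ℂ) • ad (c • covDstar T U k₀ (A p.1) p.2) (tauB T U k₀ (tauF T U p.1 (fun z => G (k₀, z))) p.2)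
        - (I : ℂ) • ad (c • covDstar T U k₀ (tauF T U p.1 (A k₀)) p.2) (tauB T U k₀ (tauF T U p.1 (fun z => G (k₀, z))) p.2)
        + (I : ℂ) • ad (c • covDstar T U k₀ (A k₀) p.2) (tauB T U k₀ (fun z => G (k₀, z)) p.2) := by
  obtain ⟨μ, x⟩ := p
  simp only [LinearMap.sub_apply, Module.End.mul_apply, Pi.sub_apply, diffLetter_inr, LinearMap.neg_apply, map_neg,
    Pi.neg_apply, gradLetterB_apply, covDstar_bond, mixLetterB₂_apply]
  rw [← bracketB₂_comm T U c k₀ μ (A μ) (A k₀) (fun z => G (k₀, z)) x]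
  abel

end Identities

/-! ## §3  Block majorants: the two curvature members, and `hComm` complete for the concrete `V₃` -/

section Majorants

variable {𝔸 : Type*} [NormedRing 𝔸] [NormedAlgebra ℂ 𝔸] {ι : Type} [Fintype ι]
variable (b : Module.Basis ι ℝ 𝔸) {S : Type} {κ : Type}
variable (T : κ → Equiv.Perm S) (U : κ → S → 𝔸ˣ)
variable {g : B9.Geometry} [Fintype g.Site] {Rr : ℝ} {H : Prop}

omit [Fintype ι] b T U [Fintype g.Site] in
/-- `‖i·[a, Z]‖ ≦ 2st` when `‖a‖ ≦ s`, `‖Z‖ ≦ t`. [folklore] -/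
private theorem norm_I_ad_le {a Z : 𝔸} {s t : ℝ} (ha : ‖a‖ ≤ s) (hZ : ‖Z‖ ≤ t) : ‖(I : ℂ) • ad a Z‖ ≤ 2 * s * t := by
  rw [norm_smul, Complex.norm_I, one_mul]
  have hs : 0 ≤ s := (norm_nonneg _).trans ha
  exact (norm_ad_le _ _).trans (mul_le_mul (mul_le_mul_of_nonneg_left ha zero_le_two) hZ (norm_nonneg _) (by positivity))

omit [Fintype ι] b T U [Fintype g.Site] [NormedAlgebra ℂ 𝔸] in
/-- `‖a − b + c − d + e‖ ≦ ‖a‖ + ‖b‖ + ‖c‖ + ‖d‖ + ‖e‖`. [folklore] -/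
private theorem norm_five_le (a₁ a₂ a₃ a₄ a₅ : 𝔸) : ‖a₁ - a₂ + a₃ - a₄ + a₅‖ ≤ ‖a₁‖ + ‖a₂‖ + ‖a₃‖ + ‖a₄‖ + ‖a₅‖ :=
  (norm_add_le _ _).trans (add_le_add ((norm_sub_le _ _).trans (add_le_add ((norm_add_le _ _).trans
    (add_le_add (norm_sub_le _ _) le_rfl)) le_rfl)) le_rfl)

omit [Fintype ι] b T U [Fintype g.Site] in
/-- The indicator scalar does not increase the norm: `‖𝟙[P]·X‖ ≦ ‖X‖`. [folklore] -/
private theorem norm_ite_smul_le (P : Prop) [Decidable P] (X : 𝔸) : ‖(if P then (1 : ℝ) else 0) • X‖ ≤ ‖X‖ := by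
  split_ifs <;> simp

omit [Fintype ι] b T U [Fintype g.Site] [NormedAlgebra ℂ 𝔸] in
/-- `‖η⁻¹‖ = η⁻¹` for the complexified lattice spacing. [folklore] -/
private theorem norm_eta_inv (hη : 0 < g.eta) : ‖((g.eta : ℂ)⁻¹)‖ = g.eta⁻¹ := by
  rw [norm_inv, Complex.norm_real, Real.norm_of_nonneg hη.le]

omit [Fintype ι] b T U [Fintype g.Site] [NormedAlgebra ℂ 𝔸] in
/-- **THE SCALE BOOKKEEPING OF THE CURVATURE TERMS**: with `η = g.eta > 0`, `L ≧ 1` (so `η ≦ Lʲη = g.len y`): `η⁻¹·(C₀L^{−2j})·(α₁(Lʲη)⁻¹) ≦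
C₀α₁(Lʲη)⁻²` — a curvature factor `η²(Lʲη)⁻²` of (3.35), the coefficient size `α₁(Lʲη)⁻¹` of (3.37) and the `η⁻¹` of the difference letter
give the second-order size `α₁(Lʲη)⁻²` of (3.73). [cite: Balaban1985BackgroundPropagators, (3.35) p.396 + (3.37) p.396 + (3.73) p.405] -/
theorem curv_coeff_le (hη : 0 < g.eta) (hL : 1 ≤ g.L) {C₀ α₁ : ℝ} (hC₀ : 0 ≤ C₀) (hα₁ : 0 ≤ α₁) (y : g.Site) :
    g.eta⁻¹ * (C₀ * ((g.L ^ g.scale y)⁻¹) ^ 2) * (α₁ * (g.len y)⁻¹) ≤ C₀ * α₁ * (g.len y ^ 2)⁻¹ := by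
  have hLj : 1 ≤ g.L ^ g.scale y := one_le_pow₀ hL
  have key : (g.L ^ g.scale y)⁻¹ ≤ 1 := inv_le_one_of_one_le₀ hLj
  have hη0 : g.eta ≠ 0 := hη.ne'
  have hfac : 0 ≤ C₀ * α₁ * (g.eta ^ 2)⁻¹ * ((g.L ^ g.scale y) ^ 2)⁻¹ := by positivity
  simp only [B9.Geometry.len]
  calc g.eta⁻¹ * (C₀ * ((g.L ^ g.scale y)⁻¹) ^ 2) * (α₁ * (g.L ^ g.scale y * g.eta)⁻¹)
      = C₀ * α₁ * (g.eta ^ 2)⁻¹ * ((g.L ^ g.scale y) ^ 2)⁻¹ * (g.L ^ g.scale y)⁻¹ := by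
        field_simp
    _ ≤ C₀ * α₁ * (g.eta ^ 2)⁻¹ * ((g.L ^ g.scale y) ^ 2)⁻¹ * 1 := mul_le_mul_of_nonneg_left key hfac
    _ = C₀ * α₁ * ((g.L ^ g.scale y * g.eta) ^ 2)⁻¹ := by
        field_simp

omit [Fintype ι] b T U in
/-- `−L` has the majorants of `L`. [folklore] -/
private theorem hasMajorant_neg' {X : Type} (blk : X → g.Site) {L : Module.End ℝ (X → ℝ)}
    {K : g.Site → g.Site → ℝ} (h : HasMajorant (g := toB6 g Rr H) blk L K) : HasMajorant (g := toB6 g Rr H) blk (-L) K := by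
  intro y' μ B hμ x
  simpa using h y' μ B hμ x

/-- **THE `mixLetterF` CURVATURE MEMBER IS `O(1)α₁(Lʲη)⁻²`**: for commuting shifts, `η = g.eta > 0`, `L ≧ 1`, transports `≦ ρ`, (3.35) on
the plaquettes adjacent to the output bond (`‖U(∂p_{mn}(x − e_n)) − 1‖ ≦ C₀L^{−2j(y(x))}`), (3.37) blockwise (`‖τ*_νA_k(x)‖`, `‖A_k(x + e_μ −
e_ν)‖ ≦ α₁(Lʲη)⁻¹`; `‖η⁻¹D¹_μA_ν(x)‖`, `‖η⁻¹D¹_μA_k(x − e_ν)‖ ≦ α₁(Lʲη)⁻²`) and stencil block distances `≦ d₀`: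
`conj b ([mixLetterF A k₀, ∇_{inl k₀}]) ≺ d(2ρ² + 4ρ⁶ + (8ρ¹⁰ + 8ρ¹⁴)C₀)·M₂(Σ‖b_i‖)e^{δd₀}·α₁(Lʲη)⁻²·e^{−δd}`.
[cite: Balaban1985BackgroundPropagators, (3.71) p.404–405 + (3.73) p.405 + (3.35) p.396 + (3.37) p.396; Balaban1985RegularSpaces, (1.87) p.91; Balaban1984PropagatorsII, (2.51)–(2.52) p.232] -/
theorem hasMajorant_comm_mixLetterF [Fintype κ] [DecidableEq κ] (blk : S → g.Site) (hη : 0 < g.eta) (hL : 1 ≤ g.L)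
    (A : κ → S → 𝔸) (ρ C₀ d₀ δ M₂ α₁ : ℝ)
    (hα₁ : 0 ≤ α₁) (hC₀ : 0 ≤ C₀) (hδ : 0 ≤ δ) (hM₂ : 0 ≤ M₂) (hrepr : ∀ (v : 𝔸) (i : ι), |b.repr v i| ≤ M₂ * ‖v‖)
    (hT : ∀ (μ ν : κ) (x : S), T μ (T ν x) = T ν (T μ x))
    (hρ : ∀ μ x, ‖((U μ x : 𝔸ˣ) : 𝔸)‖ ≤ ρ ∧ ‖(((U μ x)⁻¹ : 𝔸ˣ) : 𝔸)‖ ≤ ρ)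
    (hAτB : ∀ ν k x, ‖tauB T U ν (A k) x‖ ≤ α₁ * (g.len (blk x))⁻¹)
    (hAFB : ∀ k μ ν x, ‖A k ((T ν).symm (T μ x))‖ ≤ α₁ * (g.len (blk x))⁻¹)
    (h337F : ∀ μ ν x, ‖((g.eta : ℂ)⁻¹) • covD T U μ (A ν) x‖ ≤ α₁ * (g.len (blk x) ^ 2)⁻¹)
    (h337FB : ∀ μ ν k x, ‖((g.eta : ℂ)⁻¹) • covD T U μ (A k) ((T ν).symm x)‖ ≤ α₁ * (g.len (blk x) ^ 2)⁻¹)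
    (h35 : ∀ m n x, ‖(plaqU T U m n ((T n).symm x) : 𝔸) - 1‖ ≤ C₀ * ((g.L ^ g.scale (blk x))⁻¹) ^ 2)
    (hd₀F : ∀ μ x, g.dist (blk x) (blk (T μ x)) ≤ d₀)
    (hd₀FB : ∀ μ ν x, g.dist (blk x) (blk ((T ν).symm (T μ x))) ≤ d₀) (k₀ : κ) :
    HasMajorant (g := toB6 g Rr H) (fun q : (κ × S) × ι => blk q.1.2)
      (conj b (mixLetterF T U A k₀ * diffLetter (bT T) (bU U) ((g.eta : ℂ)⁻¹) (Sum.inl k₀)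
        - diffLetter (bT T) (bU U) ((g.eta : ℂ)⁻¹) (Sum.inl k₀) * mixLetterF T U A k₀))
      (fun y y' => (Fintype.card κ * (2 * ρ ^ 2 + 4 * ρ ^ 6 + (8 * ρ ^ 10 + 8 * ρ ^ 14) * C₀) * M₂ * (∑ i, ‖b i‖) *
        Real.exp (δ * d₀)) * α₁ * (g.len y ^ 2)⁻¹ * Real.exp (-(δ * g.dist y y'))) := by
  set cF : ℝ := 2 * ρ ^ 2 + 4 * ρ ^ 6 + (8 * ρ ^ 10 + 8 * ρ ^ 14) * C₀ with hcF
  have hcF0 : 0 ≤ cF := by positivity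
  have hc0 : ∀ y : g.Site, 0 ≤ Fintype.card κ * cF * α₁ * (g.len y ^ 2)⁻¹ := fun y => by positivity
  refine hasMajorant_mono (g := toB6 g Rr H) _
    (hasMajorant_conj_of_local (Rr := Rr) (H := H) b (fun p : κ × S => blk p.2)
      (fun p q => q.2 = T k₀ p.2 ∨ q.2 = (T q.1).symm (T k₀ p.2))
      (fun y => Fintype.card κ * cF * α₁ * (g.len y ^ 2)⁻¹) d₀ δ M₂ hc0 hδ hM₂ hrepr ?_ _ ?_)
    fun y y' => le_of_eq (by ring)
  · rintro p q (h | h)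
    · rw [h]; exact hd₀F k₀ p.2
    · rw [h]; exact hd₀FB k₀ q.1 p.2
  · intro F p B hB
    have hρ0 : 0 ≤ ρ := (norm_nonneg _).trans (hρ k₀ p.2).1
    have hB0 : 0 ≤ B := (norm_nonneg _).trans (hB (k₀, T k₀ p.2) (Or.inl rfl))
    have hηi : 0 ≤ g.eta⁻¹ := inv_nonneg.mpr hη.le
    rw [comm_mixLetterF_apply]
    -- the per-component bound
    have key : ∀ ν : κ,
        ‖(I : ℂ) • ad (tauB T U ν (A ν) p.2) (((g.eta : ℂ)⁻¹) • (covD T U k₀ (tauB T U ν (fun z => F (ν, z))) p.2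
              - tauB T U ν (covD T U k₀ (fun z => F (ν, z))) p.2))
          - (I : ℂ) • ad (tauB T U ν (A k₀) p.2) (((g.eta : ℂ)⁻¹) • (covD T U k₀ (tauB T U ν (fun z => F (ν, z))) p.2
              - tauB T U ν (covD T U k₀ (fun z => F (ν, z))) p.2))
          + (I : ℂ) • ad (((g.eta : ℂ)⁻¹) • covD T U k₀ (tauB T U ν (A ν)) p.2)
              (tauF T U k₀ (tauB T U ν (fun z => F (ν, z))) p.2)
          - (I : ℂ) • ad (((g.eta : ℂ)⁻¹) • covD T U k₀ (tauB T U ν (A k₀)) p.2)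
              (tauF T U k₀ (tauB T U ν (fun z => F (ν, z))) p.2)
          + (I : ℂ) • ad (((g.eta : ℂ)⁻¹) • covD T U k₀ (A k₀) p.2) (tauF T U k₀ (fun z => F (ν, z)) p.2)‖
          ≤ cF * α₁ * (g.len (blk p.2) ^ 2)⁻¹ * B := by
      intro ν
      have hF2 : ‖F (ν, (T ν).symm (T k₀ p.2))‖ ≤ B := hB (ν, (T ν).symm (T k₀ p.2)) (Or.inr rfl)
      have hF3 : ‖F (ν, T k₀ p.2)‖ ≤ B := hB (ν, T k₀ p.2) (Or.inl rfl)
      -- the transport–difference commutator on the test field: curvature × B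
      have hComm : ‖((g.eta : ℂ)⁻¹) • (covD T U k₀ (tauB T U ν (fun z => F (ν, z))) p.2
            - tauB T U ν (covD T U k₀ (fun z => F (ν, z))) p.2)‖
          ≤ g.eta⁻¹ * (2 * ρ ^ 10 * (C₀ * ((g.L ^ g.scale (blk p.2))⁻¹) ^ 2) * B) := by
        rw [norm_smul, norm_eta_inv hη]
        refine mul_le_mul_of_nonneg_left ((norm_covD_tauB_comm_le T U hT hρ k₀ ν _ p.2).trans ?_) hηi
        exact mul_le_mul (mul_le_mul_of_nonneg_left (h35 k₀ ν p.2) (by positivity)) hF2 (norm_nonneg _)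
          (by positivity)
      -- the transported test fields
      have hτ2 : ‖tauF T U k₀ (tauB T U ν (fun z => F (ν, z))) p.2‖ ≤ ρ ^ 2 * (ρ ^ 2 * B) := by
        rw [tauF_apply, tauB_apply]
        exact (norm_R_le_rho (hρ k₀ p.2).1 (hρ k₀ p.2).2 _).trans (mul_le_mul_of_nonneg_left
          ((norm_R_inv_le_rho (hρ ν _).1 (hρ ν _).2 _).trans (mul_le_mul_of_nonneg_left hF2 (sq_nonneg ρ)))
          (sq_nonneg ρ))
      have hτ1 : ‖tauF T U k₀ (fun z => F (ν, z)) p.2‖ ≤ ρ ^ 2 * B := by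
        rw [tauF_apply]
        exact (norm_R_le_rho (hρ k₀ p.2).1 (hρ k₀ p.2).2 _).trans (mul_le_mul_of_nonneg_left hF3 (sq_nonneg ρ))
      -- the differences of the transported coefficients: transported difference + curvature
      have hDτ : ∀ k', ‖((g.eta : ℂ)⁻¹) • covD T U k₀ (tauB T U ν (A k')) p.2‖
          ≤ (ρ ^ 2 + 2 * ρ ^ 10 * C₀) * (α₁ * (g.len (blk p.2) ^ 2)⁻¹) := by
        intro k'
        refine (norm_smul_covD_tauB_le T U hT hρ k₀ ν _ (A k') p.2).trans ?_
        rw [norm_eta_inv hη]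
        have h2 : g.eta⁻¹ * (2 * ρ ^ 10 * ‖(plaqU T U k₀ ν ((T ν).symm p.2) : 𝔸) - 1‖ * ‖A k' ((T ν).symm (T k₀ p.2))‖)
            ≤ 2 * ρ ^ 10 * (C₀ * α₁ * (g.len (blk p.2) ^ 2)⁻¹) :=
          calc g.eta⁻¹ * (2 * ρ ^ 10 * ‖(plaqU T U k₀ ν ((T ν).symm p.2) : 𝔸) - 1‖ * ‖A k' ((T ν).symm (T k₀ p.2))‖)
              ≤ g.eta⁻¹ * (2 * ρ ^ 10 * (C₀ * ((g.L ^ g.scale (blk p.2))⁻¹) ^ 2) * (α₁ * (g.len (blk p.2))⁻¹)) :=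
                mul_le_mul_of_nonneg_left (mul_le_mul (mul_le_mul_of_nonneg_left (h35 k₀ ν p.2) (by positivity))
                  (hAFB k' k₀ ν p.2) (norm_nonneg _) (by positivity)) hηi
            _ = 2 * ρ ^ 10 * (g.eta⁻¹ * (C₀ * ((g.L ^ g.scale (blk p.2))⁻¹) ^ 2) * (α₁ * (g.len (blk p.2))⁻¹)) := by
                ring
            _ ≤ 2 * ρ ^ 10 * (C₀ * α₁ * (g.len (blk p.2) ^ 2)⁻¹) :=
                mul_le_mul_of_nonneg_left (curv_coeff_le hη hL hC₀ hα₁ (blk p.2)) (by positivity)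
        calc ρ ^ 2 * ‖((g.eta : ℂ)⁻¹) • covD T U k₀ (A k') ((T ν).symm p.2)‖
              + g.eta⁻¹ * (2 * ρ ^ 10 * ‖(plaqU T U k₀ ν ((T ν).symm p.2) : 𝔸) - 1‖ * ‖A k' ((T ν).symm (T k₀ p.2))‖)
            ≤ ρ ^ 2 * (α₁ * (g.len (blk p.2) ^ 2)⁻¹) + 2 * ρ ^ 10 * (C₀ * α₁ * (g.len (blk p.2) ^ 2)⁻¹) :=
              add_le_add (mul_le_mul_of_nonneg_left (h337FB k₀ ν k' p.2) (sq_nonneg ρ)) h2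
          _ = (ρ ^ 2 + 2 * ρ ^ 10 * C₀) * (α₁ * (g.len (blk p.2) ^ 2)⁻¹) := by ring
      -- the five terms
      have hcurv : 2 * (α₁ * (g.len (blk p.2))⁻¹) * (g.eta⁻¹ * (2 * ρ ^ 10 * (C₀ * ((g.L ^ g.scale (blk p.2))⁻¹) ^ 2) * B))
          ≤ 4 * ρ ^ 10 * (C₀ * α₁ * (g.len (blk p.2) ^ 2)⁻¹) * B :=
        calc 2 * (α₁ * (g.len (blk p.2))⁻¹) * (g.eta⁻¹ * (2 * ρ ^ 10 * (C₀ * ((g.L ^ g.scale (blk p.2))⁻¹) ^ 2) * B))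
            = 4 * ρ ^ 10 * B * (g.eta⁻¹ * (C₀ * ((g.L ^ g.scale (blk p.2))⁻¹) ^ 2) * (α₁ * (g.len (blk p.2))⁻¹)) := by
              ring
          _ ≤ 4 * ρ ^ 10 * B * (C₀ * α₁ * (g.len (blk p.2) ^ 2)⁻¹) :=
              mul_le_mul_of_nonneg_left (curv_coeff_le hη hL hC₀ hα₁ (blk p.2)) (by positivity)
          _ = 4 * ρ ^ 10 * (C₀ * α₁ * (g.len (blk p.2) ^ 2)⁻¹) * B := by ring
      have ta := (norm_I_ad_le (hAτB ν ν p.2) hComm).trans hcurv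
      have tb := (norm_I_ad_le (hAτB ν k₀ p.2) hComm).trans hcurv
      have tc := norm_I_ad_le (hDτ ν) hτ2
      have td := norm_I_ad_le (hDτ k₀) hτ2
      have te := norm_I_ad_le (h337F k₀ k₀ p.2) hτ1
      refine (norm_five_le _ _ _ _ _).trans ((add_le_add (add_le_add (add_le_add (add_le_add ta tb) tc) td) te).trans
        (le_of_eq ?_))
      rw [hcF]; ring
    -- the sum over the input components and the indicator of the output component
    refine (norm_ite_smul_le _ _).trans ((norm_sum_le _ _).trans ((Finset.sum_le_sum fun ν _ => key ν).trans (le_of_eq ?_)))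
    rw [Finset.sum_const, Finset.card_univ, nsmul_eq_mul]
    ring

/-- **THE `mixLetterB₂` CURVATURE MEMBER IS `O(1)α₁(Lʲη)⁻²`**: for commuting shifts, `η = g.eta > 0`, `L ≧ 1`, transports `≦ ρ`, (3.35) on
the plaquettes adjacent to the output bond, (3.37) blockwise (`‖A_k(x)‖`, `‖τ_μA_k(x)‖`, `‖A_k(x + e_μ − e_ν)‖ ≦ α₁(Lʲη)⁻¹`; `‖η⁻¹D¹*_νA_k(x)‖`,
`‖η⁻¹D¹*_νA_ν(x + e_μ)‖ ≦ α₁(Lʲη)⁻²`) and stencil block distances `≦ d₀`: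
`conj b ([mixLetterB₂ A k₀, ∇_{inr k₀}]) ≺ (2ρ² + 2ρ⁴ + 2ρ⁶ + (8ρ¹⁰ + 4ρ¹⁴)C₀)·M₂(Σ‖b_i‖)e^{δd₀}·α₁(Lʲη)⁻²·e^{−δd}`.
[cite: Balaban1985BackgroundPropagators, (3.75) p.405 + (3.73) p.405 + (3.35) p.396 + (3.37) p.396; Balaban1985RegularSpaces, (1.87) p.91; Balaban1984PropagatorsII, (2.51)–(2.52) p.232] -/
theorem hasMajorant_comm_mixLetterB₂ (blk : S → g.Site) (hη : 0 < g.eta) (hL : 1 ≤ g.L)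
    (A : κ → S → 𝔸) (ρ C₀ d₀ δ M₂ α₁ : ℝ)
    (hα₁ : 0 ≤ α₁) (hC₀ : 0 ≤ C₀) (hδ : 0 ≤ δ) (hM₂ : 0 ≤ M₂) (hrepr : ∀ (v : 𝔸) (i : ι), |b.repr v i| ≤ M₂ * ‖v‖)
    (hT : ∀ (μ ν : κ) (x : S), T μ (T ν x) = T ν (T μ x))
    (hρ : ∀ μ x, ‖((U μ x : 𝔸ˣ) : 𝔸)‖ ≤ ρ ∧ ‖(((U μ x)⁻¹ : 𝔸ˣ) : 𝔸)‖ ≤ ρ)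
    (hA : ∀ k x, ‖A k x‖ ≤ α₁ * (g.len (blk x))⁻¹)
    (hAτF : ∀ μ k x, ‖tauF T U μ (A k) x‖ ≤ α₁ * (g.len (blk x))⁻¹)
    (hAFB : ∀ k μ ν x, ‖A k ((T ν).symm (T μ x))‖ ≤ α₁ * (g.len (blk x))⁻¹)
    (h337B : ∀ ν k x, ‖((g.eta : ℂ)⁻¹) • covDstar T U ν (A k) x‖ ≤ α₁ * (g.len (blk x) ^ 2)⁻¹)
    (h337B' : ∀ μ ν x, ‖((g.eta : ℂ)⁻¹) • covDstar T U ν (A ν) (T μ x)‖ ≤ α₁ * (g.len (blk x) ^ 2)⁻¹)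
    (h35 : ∀ m n x, ‖(plaqU T U m n ((T n).symm x) : 𝔸) - 1‖ ≤ C₀ * ((g.L ^ g.scale (blk x))⁻¹) ^ 2)
    (hd₀B : ∀ μ x, g.dist (blk x) (blk ((T μ).symm x)) ≤ d₀)
    (hd₀FB : ∀ μ ν x, g.dist (blk x) (blk ((T ν).symm (T μ x))) ≤ d₀) (k₀ : κ) :
    HasMajorant (g := toB6 g Rr H) (fun q : (κ × S) × ι => blk q.1.2)
      (conj b (mixLetterB₂ T U A k₀ * diffLetter (bT T) (bU U) ((g.eta : ℂ)⁻¹) (Sum.inr k₀)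
        - diffLetter (bT T) (bU U) ((g.eta : ℂ)⁻¹) (Sum.inr k₀) * mixLetterB₂ T U A k₀))
      (fun y y' => ((2 * ρ ^ 2 + 2 * ρ ^ 4 + 2 * ρ ^ 6 + (8 * ρ ^ 10 + 4 * ρ ^ 14) * C₀) * M₂ * (∑ i, ‖b i‖) *
        Real.exp (δ * d₀)) * α₁ * (g.len y ^ 2)⁻¹ * Real.exp (-(δ * g.dist y y'))) := by
  set cB : ℝ := 2 * ρ ^ 2 + 2 * ρ ^ 4 + 2 * ρ ^ 6 + (8 * ρ ^ 10 + 4 * ρ ^ 14) * C₀ with hcB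
  have hcB0 : 0 ≤ cB := by positivity
  have hc0 : ∀ y : g.Site, 0 ≤ cB * α₁ * (g.len y ^ 2)⁻¹ := fun y => by positivity
  refine hasMajorant_mono (g := toB6 g Rr H) _
    (hasMajorant_conj_of_local (Rr := Rr) (H := H) b (fun p : κ × S => blk p.2)
      (fun p q => q.2 = (T k₀).symm p.2 ∨ q.2 = (T k₀).symm (T p.1 p.2))
      (fun y => cB * α₁ * (g.len y ^ 2)⁻¹) d₀ δ M₂ hc0 hδ hM₂ hrepr ?_ _ ?_)
    fun y y' => le_of_eq (by ring)
  · rintro p q (h | h)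
    · rw [h]; exact hd₀B k₀ p.2
    · rw [h]; exact hd₀FB p.1 k₀ p.2
  · intro G p B hB
    have hρ0 : 0 ≤ ρ := (norm_nonneg _).trans (hρ k₀ p.2).1
    have hB0 : 0 ≤ B := (norm_nonneg _).trans (hB (k₀, (T k₀).symm p.2) (Or.inl rfl))
    have hηi : 0 ≤ g.eta⁻¹ := inv_nonneg.mpr hη.le
    rw [comm_mixLetterB₂_apply]
    have hz : T p.1 ((T k₀).symm p.2) = (T k₀).symm (T p.1 p.2) := shift_symm_comm T hT p.1 k₀ p.2
    have hG2 : ‖G (k₀, (T k₀).symm (T p.1 p.2))‖ ≤ B := hB (k₀, (T k₀).symm (T p.1 p.2)) (Or.inr rfl)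
    have hG1 : ‖G (k₀, T p.1 ((T k₀).symm p.2))‖ ≤ B := by rw [hz]; exact hG2
    have hG3 : ‖G (k₀, (T k₀).symm p.2)‖ ≤ B := hB (k₀, (T k₀).symm p.2) (Or.inl rfl)
    -- the transport–difference commutator on the test field
    have hComm : ‖((g.eta : ℂ)⁻¹) • (covDstar T U k₀ (tauF T U p.1 (fun z => G (k₀, z))) p.2
          - tauF T U p.1 (covDstar T U k₀ (fun z => G (k₀, z))) p.2)‖
        ≤ g.eta⁻¹ * (2 * ρ ^ 10 * (C₀ * ((g.L ^ g.scale (blk p.2))⁻¹) ^ 2) * B) := by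
      rw [norm_smul, norm_eta_inv hη]
      refine mul_le_mul_of_nonneg_left ((norm_covDstar_tauF_comm_le T U hT hρ k₀ p.1 _ p.2).trans ?_) hηi
      exact mul_le_mul (mul_le_mul_of_nonneg_left (h35 p.1 k₀ p.2) (by positivity)) hG2 (norm_nonneg _) (by positivity)
    -- the transported test fields
    have hτ2 : ‖tauB T U k₀ (tauF T U p.1 (fun z => G (k₀, z))) p.2‖ ≤ ρ ^ 2 * (ρ ^ 2 * B) := by
      rw [tauB_apply, tauF_apply]
      exact (norm_R_inv_le_rho (hρ k₀ _).1 (hρ k₀ _).2 _).trans (mul_le_mul_of_nonneg_left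
        ((norm_R_le_rho (hρ p.1 _).1 (hρ p.1 _).2 _).trans (mul_le_mul_of_nonneg_left hG1 (sq_nonneg ρ))) (sq_nonneg ρ))
    have hτ1 : ‖tauB T U k₀ (fun z => G (k₀, z)) p.2‖ ≤ ρ ^ 2 * B := by
      rw [tauB_apply]
      exact (norm_R_inv_le_rho (hρ k₀ _).1 (hρ k₀ _).2 _).trans (mul_le_mul_of_nonneg_left hG3 (sq_nonneg ρ))
    -- the difference of the transported coefficient: transported difference + curvature
    have hDτ : ‖((g.eta : ℂ)⁻¹) • covDstar T U k₀ (tauF T U p.1 (A k₀)) p.2‖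
        ≤ (ρ ^ 2 + 2 * ρ ^ 10 * C₀) * (α₁ * (g.len (blk p.2) ^ 2)⁻¹) := by
      refine (norm_smul_covDstar_tauF_le T U hT hρ k₀ p.1 _ (A k₀) p.2).trans ?_
      rw [norm_eta_inv hη]
      have h2 : g.eta⁻¹ * (2 * ρ ^ 10 * ‖(plaqU T U p.1 k₀ ((T k₀).symm p.2) : 𝔸) - 1‖ * ‖A k₀ ((T k₀).symm (T p.1 p.2))‖)
          ≤ 2 * ρ ^ 10 * (C₀ * α₁ * (g.len (blk p.2) ^ 2)⁻¹) :=
        calc g.eta⁻¹ * (2 * ρ ^ 10 * ‖(plaqU T U p.1 k₀ ((T k₀).symm p.2) : 𝔸) - 1‖ * ‖A k₀ ((T k₀).symm (T p.1 p.2))‖)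
            ≤ g.eta⁻¹ * (2 * ρ ^ 10 * (C₀ * ((g.L ^ g.scale (blk p.2))⁻¹) ^ 2) * (α₁ * (g.len (blk p.2))⁻¹)) :=
              mul_le_mul_of_nonneg_left (mul_le_mul (mul_le_mul_of_nonneg_left (h35 p.1 k₀ p.2) (by positivity))
                (hAFB k₀ p.1 k₀ p.2) (norm_nonneg _) (by positivity)) hηi
          _ = 2 * ρ ^ 10 * (g.eta⁻¹ * (C₀ * ((g.L ^ g.scale (blk p.2))⁻¹) ^ 2) * (α₁ * (g.len (blk p.2))⁻¹)) := by ring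
          _ ≤ 2 * ρ ^ 10 * (C₀ * α₁ * (g.len (blk p.2) ^ 2)⁻¹) :=
              mul_le_mul_of_nonneg_left (curv_coeff_le hη hL hC₀ hα₁ (blk p.2)) (by positivity)
      calc ρ ^ 2 * ‖((g.eta : ℂ)⁻¹) • covDstar T U k₀ (A k₀) (T p.1 p.2)‖
            + g.eta⁻¹ * (2 * ρ ^ 10 * ‖(plaqU T U p.1 k₀ ((T k₀).symm p.2) : 𝔸) - 1‖ * ‖A k₀ ((T k₀).symm (T p.1 p.2))‖)
          ≤ ρ ^ 2 * (α₁ * (g.len (blk p.2) ^ 2)⁻¹) + 2 * ρ ^ 10 * (C₀ * α₁ * (g.len (blk p.2) ^ 2)⁻¹) :=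
            add_le_add (mul_le_mul_of_nonneg_left (h337B' p.1 k₀ p.2) (sq_nonneg ρ)) h2
        _ = (ρ ^ 2 + 2 * ρ ^ 10 * C₀) * (α₁ * (g.len (blk p.2) ^ 2)⁻¹) := by ring
    -- the five terms
    have hcurv : 2 * (α₁ * (g.len (blk p.2))⁻¹) * (g.eta⁻¹ * (2 * ρ ^ 10 * (C₀ * ((g.L ^ g.scale (blk p.2))⁻¹) ^ 2) * B))
        ≤ 4 * ρ ^ 10 * (C₀ * α₁ * (g.len (blk p.2) ^ 2)⁻¹) * B :=
      calc 2 * (α₁ * (g.len (blk p.2))⁻¹) * (g.eta⁻¹ * (2 * ρ ^ 10 * (C₀ * ((g.L ^ g.scale (blk p.2))⁻¹) ^ 2) * B))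
          = 4 * ρ ^ 10 * B * (g.eta⁻¹ * (C₀ * ((g.L ^ g.scale (blk p.2))⁻¹) ^ 2) * (α₁ * (g.len (blk p.2))⁻¹)) := by
            ring
        _ ≤ 4 * ρ ^ 10 * B * (C₀ * α₁ * (g.len (blk p.2) ^ 2)⁻¹) :=
            mul_le_mul_of_nonneg_left (curv_coeff_le hη hL hC₀ hα₁ (blk p.2)) (by positivity)
        _ = 4 * ρ ^ 10 * (C₀ * α₁ * (g.len (blk p.2) ^ 2)⁻¹) * B := by ring
    have ta := (norm_I_ad_le (hA p.1 p.2) hComm).trans hcurv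
    have tb := (norm_I_ad_le (hAτF p.1 k₀ p.2) hComm).trans hcurv
    have tc := norm_I_ad_le (h337B k₀ p.1 p.2) hτ2
    have td := norm_I_ad_le hDτ hτ2
    have te := norm_I_ad_le (h337B k₀ k₀ p.2) hτ1
    refine (norm_five_le _ _ _ _ _).trans ((add_le_add (add_le_add (add_le_add (add_le_add ta tb) tc) td) te).trans
      (le_of_eq ?_))
    rw [hcB]; ring


variable [Fintype κ] [DecidableEq κ]

/-- **`hComm` FOR `V1Letter (inl k₀)` — COMPLETE** (`V1Letter (inl k₀) = coefLetter (inl k₀) + mixLetterF k₀`): file 6's diagonal commutator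
(lattice Leibniz rule) plus the curvature member `hasMajorant_comm_mixLetterF`:
`[conj b (V1Letter A (inl k₀)), conj b (∇_{inl k₀})] ≺ (2ρ² + d(2ρ² + 4ρ⁶ + (8ρ¹⁰ + 8ρ¹⁴)C₀))·M₂(Σ‖b_i‖)e^{δd₀}·α₁(Lʲη)⁻²·e^{−δd}`.
[cite: Balaban1985BackgroundPropagators, (3.71) p.404–405 + (3.73) p.405 + (3.85) p.407 + (3.35)/(3.37) p.396; Balaban1985RegularSpaces, (1.87) p.91; Balaban1984PropagatorsII, (2.51)–(2.52) p.232] -/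
theorem hasMajorant_comm_V1Letter_inl (blk : S → g.Site) (hη : 0 < g.eta) (hL : 1 ≤ g.L)
    (A : κ → S → 𝔸) (ρ C₀ d₀ δ M₂ α₁ : ℝ)
    (hα₁ : 0 ≤ α₁) (hC₀ : 0 ≤ C₀) (hδ : 0 ≤ δ) (hM₂ : 0 ≤ M₂) (hrepr : ∀ (v : 𝔸) (i : ι), |b.repr v i| ≤ M₂ * ‖v‖)
    (hT : ∀ (μ ν : κ) (x : S), T μ (T ν x) = T ν (T μ x))
    (hρ : ∀ μ x, ‖((U μ x : 𝔸ˣ) : 𝔸)‖ ≤ ρ ∧ ‖(((U μ x)⁻¹ : 𝔸ˣ) : 𝔸)‖ ≤ ρ)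
    (hAτB : ∀ ν k x, ‖tauB T U ν (A k) x‖ ≤ α₁ * (g.len (blk x))⁻¹)
    (hAFB : ∀ k μ ν x, ‖A k ((T ν).symm (T μ x))‖ ≤ α₁ * (g.len (blk x))⁻¹)
    (h337F : ∀ μ ν x, ‖((g.eta : ℂ)⁻¹) • covD T U μ (A ν) x‖ ≤ α₁ * (g.len (blk x) ^ 2)⁻¹)
    (h337Bτ : ∀ μ x, ‖((g.eta : ℂ)⁻¹) • covDstar T U μ (tauB T U μ (A μ)) x‖ ≤ α₁ * (g.len (blk x) ^ 2)⁻¹)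
    (h337FB : ∀ μ ν k x, ‖((g.eta : ℂ)⁻¹) • covD T U μ (A k) ((T ν).symm x)‖ ≤ α₁ * (g.len (blk x) ^ 2)⁻¹)
    (h35 : ∀ m n x, ‖(plaqU T U m n ((T n).symm x) : 𝔸) - 1‖ ≤ C₀ * ((g.L ^ g.scale (blk x))⁻¹) ^ 2)
    (hd₀B : ∀ μ x, g.dist (blk x) (blk ((T μ).symm x)) ≤ d₀) (hd₀F : ∀ μ x, g.dist (blk x) (blk (T μ x)) ≤ d₀)
    (hd₀FB : ∀ μ ν x, g.dist (blk x) (blk ((T ν).symm (T μ x))) ≤ d₀) (k₀ : κ) :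
    HasMajorant (g := toB6 g Rr H) (fun q : (κ × S) × ι => blk q.1.2)
      (conj b (V1Letter T U A (Sum.inl k₀)) * conj b (diffLetter (bT T) (bU U) ((g.eta : ℂ)⁻¹) (Sum.inl k₀))
        - conj b (diffLetter (bT T) (bU U) ((g.eta : ℂ)⁻¹) (Sum.inl k₀)) * conj b (V1Letter T U A (Sum.inl k₀)))
      (fun y y' => ((2 * ρ ^ 2 + Fintype.card κ * (2 * ρ ^ 2 + 4 * ρ ^ 6 + (8 * ρ ^ 10 + 8 * ρ ^ 14) * C₀)) * M₂ *
        (∑ i, ‖b i‖) * Real.exp (δ * d₀)) * α₁ * (g.len y ^ 2)⁻¹ * Real.exp (-(δ * g.dist y y'))) := by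
  have hcoef := hasMajorant_comm_coefLetter_bond (Rr := Rr) (H := H) b T U blk g.eta A ρ d₀ δ M₂ α₁ hα₁ hδ hM₂ hrepr
    (fun μ x => h337F μ μ x) h337Bτ hρ (fun μ x => ⟨hd₀F μ x, hd₀B μ x⟩) (Sum.inl k₀)
  have hmix := hasMajorant_comm_mixLetterF (Rr := Rr) (H := H) b T U blk hη hL A ρ C₀ d₀ δ M₂ α₁ hα₁ hC₀ hδ hM₂ hrepr hT hρ
    hAτB hAFB h337F h337FB h35 hd₀F hd₀FB k₀
  have hsplit : conj b (V1Letter T U A (Sum.inl k₀)) * conj b (diffLetter (bT T) (bU U) ((g.eta : ℂ)⁻¹) (Sum.inl k₀))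
        - conj b (diffLetter (bT T) (bU U) ((g.eta : ℂ)⁻¹) (Sum.inl k₀)) * conj b (V1Letter T U A (Sum.inl k₀))
      = (conj b (coefLetter (bT T) (bU U) (Ab A) (Sum.inl k₀)) * conj b (diffLetter (bT T) (bU U) ((g.eta : ℂ)⁻¹) (Sum.inl k₀))
          - conj b (diffLetter (bT T) (bU U) ((g.eta : ℂ)⁻¹) (Sum.inl k₀))
            * conj b (coefLetter (bT T) (bU U) (Ab A) (Sum.inl k₀)))
        + conj b (mixLetterF T U A k₀ * diffLetter (bT T) (bU U) ((g.eta : ℂ)⁻¹) (Sum.inl k₀)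
          - diffLetter (bT T) (bU U) ((g.eta : ℂ)⁻¹) (Sum.inl k₀) * mixLetterF T U A k₀) := by
    rw [conj_sub, B9Eq352DivFormLetters.conj_mul, B9Eq352DivFormLetters.conj_mul, V1Letter_inl, conj_add]
    noncomm_ring
  rw [hsplit]
  exact hasMajorant_mono (g := toB6 g Rr H) _ (hasMajorant_add (g := toB6 g Rr H) _ hcoef hmix)
    fun y y' => le_of_eq (by ring)

/-- **`hComm` FOR `V1Letter₂ (inr k₀)` — COMPLETE** (`V1Letter₂ (inr k₀) = mixLetterB₂ k₀`): the curvature member `hasMajorant_comm_mixLetterB₂`.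
[cite: Balaban1985BackgroundPropagators, (3.75) p.405 + (3.73) p.405 + (3.85) p.407 + (3.35)/(3.37) p.396; Balaban1985RegularSpaces, (1.87) p.91; Balaban1984PropagatorsII, (2.51)–(2.52) p.232] -/
theorem hasMajorant_comm_V1Letter₂_inr (blk : S → g.Site) (hη : 0 < g.eta) (hL : 1 ≤ g.L)
    (A : κ → S → 𝔸) (ρ C₀ d₀ δ M₂ α₁ : ℝ)
    (hα₁ : 0 ≤ α₁) (hC₀ : 0 ≤ C₀) (hδ : 0 ≤ δ) (hM₂ : 0 ≤ M₂) (hrepr : ∀ (v : 𝔸) (i : ι), |b.repr v i| ≤ M₂ * ‖v‖)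
    (hT : ∀ (μ ν : κ) (x : S), T μ (T ν x) = T ν (T μ x))
    (hρ : ∀ μ x, ‖((U μ x : 𝔸ˣ) : 𝔸)‖ ≤ ρ ∧ ‖(((U μ x)⁻¹ : 𝔸ˣ) : 𝔸)‖ ≤ ρ)
    (hA : ∀ k x, ‖A k x‖ ≤ α₁ * (g.len (blk x))⁻¹)
    (hAτF : ∀ μ k x, ‖tauF T U μ (A k) x‖ ≤ α₁ * (g.len (blk x))⁻¹)
    (hAFB : ∀ k μ ν x, ‖A k ((T ν).symm (T μ x))‖ ≤ α₁ * (g.len (blk x))⁻¹)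
    (h337B : ∀ ν k x, ‖((g.eta : ℂ)⁻¹) • covDstar T U ν (A k) x‖ ≤ α₁ * (g.len (blk x) ^ 2)⁻¹)
    (h337B' : ∀ μ ν x, ‖((g.eta : ℂ)⁻¹) • covDstar T U ν (A ν) (T μ x)‖ ≤ α₁ * (g.len (blk x) ^ 2)⁻¹)
    (h35 : ∀ m n x, ‖(plaqU T U m n ((T n).symm x) : 𝔸) - 1‖ ≤ C₀ * ((g.L ^ g.scale (blk x))⁻¹) ^ 2)
    (hd₀B : ∀ μ x, g.dist (blk x) (blk ((T μ).symm x)) ≤ d₀)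
    (hd₀FB : ∀ μ ν x, g.dist (blk x) (blk ((T ν).symm (T μ x))) ≤ d₀) (k₀ : κ) :
    HasMajorant (g := toB6 g Rr H) (fun q : (κ × S) × ι => blk q.1.2)
      (conj b (V1Letter₂ T U A (Sum.inr k₀)) * conj b (diffLetter (bT T) (bU U) ((g.eta : ℂ)⁻¹) (Sum.inr k₀))
        - conj b (diffLetter (bT T) (bU U) ((g.eta : ℂ)⁻¹) (Sum.inr k₀)) * conj b (V1Letter₂ T U A (Sum.inr k₀)))
      (fun y y' => ((2 * ρ ^ 2 + 2 * ρ ^ 4 + 2 * ρ ^ 6 + (8 * ρ ^ 10 + 4 * ρ ^ 14) * C₀) * M₂ * (∑ i, ‖b i‖) *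
        Real.exp (δ * d₀)) * α₁ * (g.len y ^ 2)⁻¹ * Real.exp (-(δ * g.dist y y'))) := by
  rw [V1Letter₂_inr, ← B9Eq352DivFormLetters.conj_mul, ← B9Eq352DivFormLetters.conj_mul, ← conj_sub]
  exact hasMajorant_comm_mixLetterB₂ (Rr := Rr) (H := H) b T U blk hη hL A ρ C₀ d₀ δ M₂ α₁ hα₁ hC₀ hδ hM₂ hrepr hT hρ hA hAτF
    hAFB h337B h337B' h35 hd₀B hd₀FB k₀

/-- **`hComm` FOR THE CONCRETE `V₃(A)` OF (3.82) — COMPLETE, every `k ∈ κ ⊕ κ`** (group-valued background `‖U^{±1}‖ ≦ 1`, commuting shifts,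
`η = g.eta > 0`, `L ≧ 1`): with `V1_k = conj b (V1Letter A k) + conj b (V1Letter₂ A k)` and `∇_k = conj b (diffLetter (bT T) (bU U) η⁻¹ k)`
exactly as in `B9Ineq385V3Concrete.ineq385_op_concreteV₃`, `V1_k∇_k − ∇_kV1_k ≺ c_K(d, C₀)·M₂(Σ‖b_i‖)e^{δd₀}·α₁(Lʲη)⁻²·e^{−δd}`, `c_K(d, C₀) =
10 + 8d + (16d + 12)C₀` (a common bound of the four members at `ρ = 1`: `inl` `2 + d(6 + 16C₀) + 2d`, `inr` `4 + 6 + 12C₀`), under (3.35) on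
the plaquettes adjacent to the output bond, (3.37) read blockwise in the shapes files 1–6 and this file read it, and the stencil block
distances — files 6–7's four members summed (`inl`: diagonal + `mixLetterF` + `mixLetterF₂`; `inr`: diagonal + `mixLetterB` + `mixLetterB₂`).
This is the hypothesis `hComm` of `B9Ineq386CommSum.thm34_G_entries13_opForm_of_comm_sum` for the concrete perturbation.
[cite: Balaban1985BackgroundPropagators, (3.73) p.405 + (3.82)/(3.85) p.407 + (3.71) p.404–405 + (3.75) p.405 + (3.35)/(3.37) p.396; Balaban1985RegularSpaces, (1.87) p.91; Balaban1984PropagatorsII, (2.51)–(2.52) p.232] -/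
theorem hasMajorant_comm_V₃_one (blk : S → g.Site) (hη : 0 < g.eta) (hL : 1 ≤ g.L) (A : κ → S → 𝔸) (C₀ d₀ δ M₂ α₁ : ℝ)
    (hα₁ : 0 ≤ α₁) (hC₀ : 0 ≤ C₀) (hδ : 0 ≤ δ) (hM₂ : 0 ≤ M₂) (hrepr : ∀ (v : 𝔸) (i : ι), |b.repr v i| ≤ M₂ * ‖v‖)
    (hT : ∀ (μ ν : κ) (x : S), T μ (T ν x) = T ν (T μ x))
    (hU1 : ∀ μ x, ‖((U μ x : 𝔸ˣ) : 𝔸)‖ ≤ 1 ∧ ‖(((U μ x)⁻¹ : 𝔸ˣ) : 𝔸)‖ ≤ 1)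
    -- (3.37) for the exponent field, blockwise, in the shapes the letters read it
    (hA : ∀ k x, ‖A k x‖ ≤ α₁ * (g.len (blk x))⁻¹)
    (hAτB : ∀ ν k x, ‖tauB T U ν (A k) x‖ ≤ α₁ * (g.len (blk x))⁻¹)
    (hAτF : ∀ μ k x, ‖tauF T U μ (A k) x‖ ≤ α₁ * (g.len (blk x))⁻¹)
    (hAFB : ∀ k μ ν x, ‖A k ((T ν).symm (T μ x))‖ ≤ α₁ * (g.len (blk x))⁻¹)
    (h337F : ∀ μ ν x, ‖((g.eta : ℂ)⁻¹) • covD T U μ (A ν) x‖ ≤ α₁ * (g.len (blk x) ^ 2)⁻¹)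
    (h337B : ∀ ν k x, ‖((g.eta : ℂ)⁻¹) • covDstar T U ν (A k) x‖ ≤ α₁ * (g.len (blk x) ^ 2)⁻¹)
    (h337B' : ∀ μ ν x, ‖((g.eta : ℂ)⁻¹) • covDstar T U ν (A ν) (T μ x)‖ ≤ α₁ * (g.len (blk x) ^ 2)⁻¹)
    (h337Bτ : ∀ μ x, ‖((g.eta : ℂ)⁻¹) • covDstar T U μ (tauB T U μ (A μ)) x‖ ≤ α₁ * (g.len (blk x) ^ 2)⁻¹)
    (h337FB : ∀ μ ν k x, ‖((g.eta : ℂ)⁻¹) • covD T U μ (A k) ((T ν).symm x)‖ ≤ α₁ * (g.len (blk x) ^ 2)⁻¹)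
    -- (3.35) on the plaquettes adjacent to the output bond, at the output block's scale
    (h35 : ∀ m n x, ‖(plaqU T U m n ((T n).symm x) : 𝔸) - 1‖ ≤ C₀ * ((g.L ^ g.scale (blk x))⁻¹) ^ 2)
    -- stencil geometry
    (hd₀B : ∀ μ x, g.dist (blk x) (blk ((T μ).symm x)) ≤ d₀) (hd₀F : ∀ μ x, g.dist (blk x) (blk (T μ x)) ≤ d₀)
    (hd₀FB : ∀ μ ν x, g.dist (blk x) (blk ((T ν).symm (T μ x))) ≤ d₀) (k : κ ⊕ κ) :
    HasMajorant (g := toB6 g Rr H) (fun q : (κ × S) × ι => blk q.1.2)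
      ((conj b (V1Letter T U A k) + conj b (V1Letter₂ T U A k)) * conj b (diffLetter (bT T) (bU U) ((g.eta : ℂ)⁻¹) k)
        - conj b (diffLetter (bT T) (bU U) ((g.eta : ℂ)⁻¹) k) * (conj b (V1Letter T U A k) + conj b (V1Letter₂ T U A k)))
      (fun y y' => ((10 + 8 * Fintype.card κ + (16 * Fintype.card κ + 12) * C₀) * M₂ * (∑ i, ‖b i‖) * Real.exp (δ * d₀)) *
        α₁ * (g.len y ^ 2)⁻¹ * Real.exp (-(δ * g.dist y y'))) := by
  have hbsum : 0 ≤ ∑ i, ‖b i‖ := Finset.sum_nonneg fun i _ => norm_nonneg _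
  have hsplit : ∀ V W D : Module.End ℝ ((κ × S) × ι → ℝ), (V + W) * D - D * (V + W) = (V * D - D * V) + (W * D - D * W) :=
    fun V W D => by noncomm_ring
  rw [hsplit]
  cases k with
  | inl k₀ =>
    have h1 := hasMajorant_comm_V1Letter_inl (Rr := Rr) (H := H) b T U blk hη hL A 1 C₀ d₀ δ M₂ α₁ hα₁ hC₀ hδ hM₂ hrepr hT hU1
      hAτB hAFB h337F h337Bτ h337FB h35 hd₀B hd₀F hd₀FB k₀
    have h2 := hasMajorant_comm_V1Letter₂_inl (Rr := Rr) (H := H) b T U blk g.eta A 1 d₀ δ M₂ α₁ hα₁ hδ hM₂ hrepr h337F hU1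
      hd₀F k₀
    refine hasMajorant_mono (g := toB6 g Rr H) _ (hasMajorant_add (g := toB6 g Rr H) _ h1 h2) fun y y' => ?_
    have hw : 0 ≤ M₂ * (∑ i, ‖b i‖) * Real.exp (δ * d₀) * α₁ * (g.len y ^ 2)⁻¹ * Real.exp (-(δ * g.dist y y')) := by
      positivity
    simp only [one_pow, mul_one]
    nlinarith [hw, mul_nonneg hC₀ hw]
  | inr k₀ =>
    have h1 := hasMajorant_comm_V1Letter_inr (Rr := Rr) (H := H) b T U blk g.eta A 1 d₀ δ M₂ α₁ hα₁ hδ hM₂ hrepr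
      (fun μ x => h337F μ μ x) h337Bτ h337B hU1 (fun μ x => ⟨hd₀F μ x, hd₀B μ x⟩) k₀
    have h2 := hasMajorant_comm_V1Letter₂_inr (Rr := Rr) (H := H) b T U blk hη hL A 1 C₀ d₀ δ M₂ α₁ hα₁ hC₀ hδ hM₂ hrepr hT hU1
      hA hAτF hAFB h337B h337B' h35 hd₀B hd₀FB k₀
    refine hasMajorant_mono (g := toB6 g Rr H) _ (hasMajorant_add (g := toB6 g Rr H) _ h1 h2) fun y y' => ?_
    have hw : 0 ≤ M₂ * (∑ i, ‖b i‖) * Real.exp (δ * d₀) * α₁ * (g.len y ^ 2)⁻¹ * Real.exp (-(δ * g.dist y y')) := by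
      positivity
    have hd : (0 : ℝ) ≤ Fintype.card κ := Nat.cast_nonneg _
    simp only [one_pow, mul_one]
    nlinarith [hw, mul_nonneg hC₀ hw, mul_nonneg hd hw, mul_nonneg (mul_nonneg hd hC₀) hw]

end Majorants

end Literature.MathematicalPhysics.QuantumFieldTheory.Balaban1983to89.B9Eq373CurvComm
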